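import Summits.BirchSwinnertonDyer.Rank1Residual.Additive.PadicClosureCyclotomicGalois
import Mathlib.FieldTheory.Galois.Infinite
import HarnessLib

/-!
# Eigen test elements in the cyclotomic layers of `ℚ̄_p`: an element of `ℚ_p(ζ_{p^{k+1}})` outside
# `ℚ_p(ζ_{p^k})`, fixed by a closed subgroup `G ⊇ Stab(ζ_{p^{k+1}})` up to a sign character
# (cell `b2b-bsdres`, CLASS-CLOSURE lane, class O10 — x1b GEN 40, class lead; file 88 of the series)

HONEST FRAMING (cell `b2b-bsdres`, run/shared/lean/b2b/bsd-rank1-residual/, verbatim in every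
file): the goal of the cell is to DELETE the COMBINATION-SHAPED residual classes of the
Birch–Swinnerton-Dyer formula for ALL analytic-rank `≤ 1` elliptic curves over `ℚ` — "full BSD
formula for every rank `≤ 1` curve in class `C`" assembled STRICTLY from published theorems — so
that the rank-`≤ 1` remainder becomes exactly the CONSTRUCTION-SHAPED classes, which are TYPED
(missing-input `Prop`s), NOT attempted. This is not "finishing BSD". CLASS-CLOSURE lane: prove
what is provable now; shrink each hard class to its core with data; no claim beyond stated classes;
research routes on CONSTRUCTION-SHAPED X12 / O10; census / instrument output = EVIDENCE / conjecture
items, NEVER a Literature fact; `RESIDUAL-MAP.md` marks change only by signed lines. THIS FILE: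
TOOL THEOREMS ONLY — no definition, no named Literature fact, no `sorry`, axioms standard; nothing
is booked; no label / mark / count / sub-cell moves; (C1_η), (C2_η-GZ), (C3_η) stay typed as filed
(cc-typer-6's pen); nothing about `BSD(W, p)` of any pair is claimed.

## What (`Ω = ℚ̄_p`, `Γ = Gal(ℚ̄_p/ℚ_p)`, `layer p m = ℚ_p(ζ_{p^m})`, `stab p m = Stab_Γ(ζ_{p^m})`)

The B3 witnesses (x1b GEN 39 note §3 (i); file 87 `KobayashiLayerLogDescent`) need ONE test
element: `y ∈ layer (k+1)`, `‖y‖ ≤ 1/4`, `y ∉ layer k`, on which a closed subgroup `G ≤ Γ`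
(there: the decomposition group over the `k`-th layer `ℚ_k·ℚ_p` of the cyclotomic `ℤ_p`-extension,
`G ⊇ Stab(ζ_{p^{k+1}})`) acts through a `±1`-valued character `χ` (there: the quadratic character
of `ℚ(√p*)`). This file supplies it from SOFT Galois theory — no Gauss sums, no normal bases:

* §1 **`exists_smul_eq_and_not_mem_layer`**: if `G` is closed, `stab (k+1) ≤ G`, and some
  `u ∈ stab k` is NOT in `G`, then some `w ∈ layer (k+1)` is fixed by `G` and `w ∉ layer k`.
  Proof: otherwise `Ω^G ⊆ layer k` is fixed by `u`, so `u ∈ Fix(Ω^G) = G` by the Galois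
  correspondence for closed subgroups (Mathlib `InfiniteGalois.fixingSubgroup_fixedField`).
* §2 **`exists_eigen_not_mem_layer`**: with moreover `t ∈ layer 1`, `t ≠ 0`, `g • t = χ(g) • t` on
  `G` (`k ≥ 1`): `y = p^N · t · w` satisfies `y ∈ layer (k+1)`, `‖y‖ ≤ 1/4`, `y ∉ layer k` and
  `g • y = χ(g) • y` for `g ∈ G`.

References: [Kobayashi2003] S. Kobayashi, Invent. Math. 152 (2003), §8.4; [NeukirchANT1999]
Ch. IV §1 (infinite Galois correspondence); [SerreLocalFields1979] Ch. IV §4.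
-/

noncomputable section

open scoped Classical

namespace Summit.BirchSwinnertonDyer.Rank1Residual.Additive

namespace PadicCyclotomicTower

open Field Field.absoluteGaloisGroup

variable {p : ℕ} [hp : Fact p.Prime]

/-! ## §1 A `G`-fixed element of `layer (k+1)` outside `layer k` -/

/-- **Soft Galois theory**: for a CLOSED subgroup `G ≤ Γ_{ℚ_p}` containing `Stab(ζ_{p^n})` and an
element `u ∈ Stab(ζ_{p^k})` with `u ∉ G`, some `w ∈ ℚ_p(ζ_{p^n})` is fixed by `G` but does not lie
in `ℚ_p(ζ_{p^k})` (otherwise `u` fixes `Ω^G`, whence `u ∈ G` by the Galois correspondence for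
closed subgroups). [cite: NeukirchANT1999, Ch. IV §1] -/
theorem exists_smul_eq_and_not_mem_layer (G : Subgroup (absoluteGaloisGroup ℚ_[p]))
    (hG : IsClosed (G : Set (absoluteGaloisGroup ℚ_[p]))) {n k : ℕ} (hle : stab p n ≤ G)
    {u : absoluteGaloisGroup ℚ_[p]} (hu : u ∈ stab p k) (huG : u ∉ G) :
    ∃ w ∈ layer p n, (∀ g ∈ G, g • w = w) ∧ w ∉ layer p k := by
  by_contra hcon
  push Not at hcon
  -- `G` as a closed subgroup of `Aut(Ω/ℚ_p)` (the identification `toAlgEquiv` is the identity)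
  let G' : ClosedSubgroup (PadicAlgCl p ≃ₐ[ℚ_[p]] PadicAlgCl p) :=
    ⟨G.comap (toAlgEquiv ℚ_[p]).symm.toMonoidHom, hG⟩
  have hmem : ∀ σ, σ ∈ G'.toSubgroup ↔ (toAlgEquiv ℚ_[p]).symm σ ∈ G := fun σ => Iff.rfl
  -- the fixed field of `G` lies in `layer k`
  have hfix : ∀ w : PadicAlgCl p, w ∈ IntermediateField.fixedField G'.toSubgroup → w ∈ layer p k := by
    intro w hw
    rw [IntermediateField.mem_fixedField_iff] at hw
    have hw' : ∀ g ∈ G, g • w = w := fun g hg => by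
      have h := hw (toAlgEquiv ℚ_[p] g) ((hmem _).mpr (by simpa using hg))
      rwa [smul_def]
    exact hcon w ((mem_layer_iff_forall_smul_eq w).mpr fun σ hσ => hw' σ (hle hσ)) hw'
  -- so `u` fixes it, i.e. `u ∈ Fix(Ω^G) = G`
  have hu' : toAlgEquiv ℚ_[p] u ∈ (IntermediateField.fixedField G'.toSubgroup).fixingSubgroup := by
    rw [IntermediateField.mem_fixingSubgroup_iff]
    intro w hw
    have h := smul_eq_self_of_mem_stab hu (hfix w hw)
    rwa [smul_def] at h
  have key := InfiniteGalois.fixingSubgroup_fixedField G'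
  rw [key] at hu'
  exact huG (by simpa using (hmem _).mp hu')

/-! ## §2 The eigen test element `y = p^N · t · w` -/

/-- `Γ` fixes `ℚ_p` (in particular the powers of `p`). [folklore] -/
theorem smul_natCast_pow (g : absoluteGaloisGroup ℚ_[p]) (N : ℕ) :
    g • ((p : PadicAlgCl p) ^ N) = (p : PadicAlgCl p) ^ N := by
  rw [smul_pow', smul_def, map_natCast]

/-- **The eigen test element.** Let `k ≥ 1`, `G ≤ Γ_{ℚ_p}` closed with `Stab(ζ_{p^{k+1}}) ≤ G`,
`u ∈ Stab(ζ_{p^k}) ∖ G`, `χ : Γ → ℤ`, and `t ∈ ℚ_p(ζ_p)`, `t ≠ 0`, with `g • t = χ(g) • t` for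
`g ∈ G`. Then there is `y ∈ ℚ_p(ζ_{p^{k+1}})` with `‖y‖ ≤ 1/4`, `y ∉ ℚ_p(ζ_{p^k})` and
`g • y = χ(g) • y` for all `g ∈ G` (`y = p^N · t · w` with `w` from §1). [cite: Kobayashi2003, §8.4]
[cite: NeukirchANT1999, Ch. IV §1] -/
theorem exists_eigen_not_mem_layer {k : ℕ} (hk : 1 ≤ k) (G : Subgroup (absoluteGaloisGroup ℚ_[p]))
    (hG : IsClosed (G : Set (absoluteGaloisGroup ℚ_[p]))) (hle : stab p (k + 1) ≤ G)
    {u : absoluteGaloisGroup ℚ_[p]} (hu : u ∈ stab p k) (huG : u ∉ G)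
    (χ : absoluteGaloisGroup ℚ_[p] → ℤ) {t : PadicAlgCl p} (ht1 : t ∈ layer p 1) (ht0 : t ≠ 0)
    (htχ : ∀ g ∈ G, g • t = χ g • t) :
    ∃ y ∈ layer p (k + 1), ‖y‖ ≤ 1 / 4 ∧ y ∉ layer p k ∧ ∀ g ∈ G, g • y = χ g • y := by
  obtain ⟨w, hwn, hwG, hwk⟩ := exists_smul_eq_and_not_mem_layer G hG hle hu huG
  have htk : t ∈ layer p k := layer_mono p hk ht1
  have htn : t ∈ layer p (k + 1) := layer_mono p (by omega) ht1
  -- `y₀ = t w`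
  set y₀ : PadicAlgCl p := t * w with hy₀
  have hy₀n : y₀ ∈ layer p (k + 1) := mul_mem htn hwn
  have hy₀k : y₀ ∉ layer p k := fun h => hwk (by
    have h' : t⁻¹ * (t * w) ∈ layer p k := mul_mem (inv_mem htk) h
    rwa [← mul_assoc, inv_mul_cancel₀ ht0, one_mul] at h')
  have hy₀0 : y₀ ≠ 0 := fun h => hy₀k (h ▸ zero_mem _)
  have hy₀χ : ∀ g ∈ G, g • y₀ = χ g • y₀ := fun g hg => by
    rw [hy₀, smul_mul', htχ g hg, hwG g hg, smul_mul_assoc]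
  -- scale by a power of `p`
  have hp0 : (0 : ℝ) < (p : ℝ)⁻¹ := inv_pos.mpr (by exact_mod_cast hp.out.pos)
  have hp1 : (p : ℝ)⁻¹ < 1 := inv_lt_one_of_one_lt₀ (by exact_mod_cast hp.out.one_lt)
  have hε : 0 < 1 / 4 / ‖y₀‖ := div_pos (by norm_num) (norm_pos_iff.mpr hy₀0)
  obtain ⟨N, hN⟩ := exists_pow_lt_of_lt_one hε hp1
  have hnp : ‖(p : PadicAlgCl p)‖ = (p : ℝ)⁻¹ := by
    rw [← map_natCast (algebraMap ℚ_[p] (PadicAlgCl p)) p]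
    exact (PadicAlgCl.norm_extends (p := p) (p : ℚ_[p])).trans Padic.norm_p
  have hpN : ((p : PadicAlgCl p) ^ N) ∈ layer p k :=
    pow_mem (by exact_mod_cast IntermediateField.natCast_mem (layer p k) p) N
  have hpN0 : ((p : PadicAlgCl p) ^ N) ≠ 0 := pow_ne_zero N (Nat.cast_ne_zero.mpr hp.out.ne_zero)
  refine ⟨(p : PadicAlgCl p) ^ N * y₀, mul_mem (layer_mono p (by omega) hpN) hy₀n, ?_, ?_, ?_⟩
  · rw [norm_mul, norm_pow, hnp]
    have h := (lt_div_iff₀ (norm_pos_iff.mpr hy₀0)).mp hN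
    exact h.le
  · intro h
    apply hy₀k
    have h' : ((p : PadicAlgCl p) ^ N)⁻¹ * ((p : PadicAlgCl p) ^ N * y₀) ∈ layer p k :=
      mul_mem (inv_mem hpN) h
    rwa [← mul_assoc, inv_mul_cancel₀ hpN0, one_mul] at h'
  · intro g hg
    rw [smul_mul', smul_natCast_pow, hy₀χ g hg, mul_smul_comm]

end PadicCyclotomicTower

end Summit.BirchSwinnertonDyer.Rank1Residual.Additive

end
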